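import Summits.QuantumFields.YangMills.Theorems.UnitScaleTiltProp8EulerLagrangeDeriv
import Summits.QuantumFields.YangMills.Theorems.UnitScaleTiltProp7FirstVariationCurrent
import Summits.QuantumFields.YangMills.Theorems.UnitScaleTiltCoverSitesPush
import Summits.QuantumFields.YangMills.Theorems.UnitScaleTiltHalvingSmallMembersCoverLift
import HarnessLib

/-!
# Route `UnitScaleTilt`, crux K1 child «MinimiserStabilityRegPr» (stmt-QuantumFields-19200), stub `stub_halvingStep` (H), residual «H-SMALL», route of record
# (b7) «COVER LIFT IN THE STATIONARITY CURRENCY» (★★OWNER RULINGS №29∕№30 (4)) — LIFT PACKAGE, piece (g4): **THE FIRST VARIATION OF THE WILSON ACTION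
# ALONG A BONDWISE-DIFFERENTIABLE CURVE IS THE TREE'S `Lin_{U₀}`** (a `HasDerivAt` statement, any torus of `Setup`, `SU(2)`), **AND ITS PUSH-FORWARD ALONG THE
# `L^{jc}`-FOLD COVER**: `Lin_{U₀ ∘ π}(ξ̃) = Lin_{U₀}(π_* ξ̃)` (`π_* = CoverSites.pushBond`, any `SU(N)`), hence
# `(d/dt) A(γ̃ t)|₀ = Lin_{U₀}(π_* ξ̃)` for every cover curve `γ̃` through the lift `U₀ ∘ π`.

Cell `ym3-torus` (HUMAN RULING D-0037: continuum `SU(2)` YM₃ on T³ is ladder rung R3 — not d = 4, not infinite volume, not a mass gap, not the Clay problem), extra width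
seat `ym-ust-20520-w7` gen 0, hand named by the lift-package holder ★`ym-ust-20520-w3` g5 (his (g4); ★★OWNER ACK 48 (3)).  `--supports stmt-QuantumFields-19200 --as helper`;
DEF-FREE (the first-variation functional `Lin_{U₀}` is written INLINE, verbatim the conclusion of ✓`Prop8Criticality.lin_eq_zero_of_isMinOn_of_hasDerivAt`; the lift of a
field `U` to the cover is written `U ∘ projBond P jc j`, as in ★w3's FILE 1 `…HalvingSmallMembersCoverLift`); 0 sorry; standard axioms.  Nothing here claims the stub, the crux,
the rung or the gap.

WHY.  The carrier's `IsCritical` is MINIMALITY (`T3Thm1Carrier.varProblem3` :109), which does not lift to the cover; FIRST-ORDER criticality does, and the H door's cone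
uses criticality only at first order (★w3-20520 g5's COVERLIFT-LOCATE; LEAD-H L-7 `RoomHalvingTextStat`).  The lift package needs two calculus facts: (1) the derivative of
`t ↦ A(γ t)` at `0` IS the tree's `Lin_{γ 0}(ξ)` for the right-trivialised bond velocities `ξ(b) = (d/dt)(γ t b · U₀(b)^*)|₀` (the tree had the two-sided quadratic expansion
✓`Prop8Criticality.abs_wilsonAction4_sub_sub_lin_le` and its Euler–Lagrange consequence, not the `HasDerivAt` statement); (2) the first variation at a LIFTED background pushes
forward to the member: `Lin_{U₀}(Z) = −½Σ_b Re Tr(Z(b)·(D^{1*}_{U₀}∂U₀)(b))` (✓`Prop7FirstVariationCurrent.lin_eq_neg_half_sum_re_trace_mul_covDivT`, [Balaban1985BackgroundPropagators]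
(3.11)) pairs the velocity with a LOCAL current, the current of the lift is the lift of the current (★w3 FILE 1 ✓`SmallMembersCoverLift.covDivT_comp_proj`), and
`Σ_{b̃} f(π b̃)·g(b̃) = Σ_b f(b)·(π_* g)(b)` (✓`CoverSites.sum_pullback_mul_eq_sum_mul_pushBond`).

WHAT IS PROVED (no definition, no sorry; our own statements — [folklore] calculus ∕ cited to the display they instantiate):
* §1 (any torus `P j` of `Setup`, `SU(2)`): `hasDerivAt_mul_star_of_differentiableAt`, ★★`hasDerivAt_wilsonAction4_of_hasDerivAt_bonds` (`HasDerivAt (A ∘ γ) (Lin_{U₀} ξ) 0`),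
  `deriv_wilsonAction4_eq_lin`, ★`hasDerivAt_wilsonAction4_current` (bond-current form), `hasDerivAt_wilsonAction4_of_differentiableAt_bonds`.
* §2 (cover `CoverSites.cover P jc`, any level `j`): `sum_re_trace_mul_covDivT_cover_eq_pushBond` (`SU(N)`), ★★`lin_cover_eq_lin_pushBond` (`SU(N)`: `Lin_{U₀ ∘ π}(ξ̃) = Lin_{U₀}(π_* ξ̃)`),
  ★★`hasDerivAt_wilsonAction4_cover` (`SU(2)`: `HasDerivAt (A ∘ γ̃) (Lin_{U₀}(π_* ξ̃)) 0`), ★`deriv_wilsonAction4_cover_eq`, T³ reading `hasDerivAt_wilsonAction4_cover_T3`.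

References: T. Bałaban, CMP **102** (1985) 277–309 [Balaban1985Variational] ((26)–(27) p.282, (127) p.297, (144) p.300); CMP **99** (1985) 389–434
[Balaban1985BackgroundPropagators] ((3.9), (3.11) p.392).
-/

noncomputable section

open scoped BigOperators Matrix.Norms.L2Operator Matrix
open Filter Topology Asymptotics

namespace Summit.QuantumFields.YangMills.Theorems.WilsonActionFirstVariation

open Literature.MathematicalPhysics.QuantumFieldTheory.Balaban1983to89
open Finset
open B10Eq27TorusAxialLog (unitsField toUField)
open T3ContinuumYM3Torus (T3Family)
open B10Eq68TorusRegularity (covDivT)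
open Summit.QuantumFields.YangMills.Theorems.Prop7FlatLocalMin (sum_plaq_bonds_le)
open Summit.QuantumFields.YangMills.Theorems.Prop8Criticality (abs_wilsonAction4_sub_sub_lin_le linPlaq_sub_smul abs_linPlaq_le norm_coe_sub_one_le_two)
open Summit.QuantumFields.YangMills.Theorems.Prop7FirstVariationCurrent (lin_eq_neg_half_sum_re_trace_mul_covDivT re_trace_mul_comm)
open Summit.QuantumFields.YangMills.Theorems.CoverSites (cover proj projBond pushBond sum_pullback_mul_eq_sum_mul_pushBond)

/-! ## §1 The derivative of the Wilson action along a bondwise-differentiable curve is `Lin_{U₀}` of the velocity -/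

section Member

variable {P : Params} {j : ℕ}

/-- Bridge from the `DifferentiableAt` letters (LEAD-H L-7 (a): `DifferentiableAt ℝ (fun t => (γ t b : M₂(ℂ))) 0`) to the RIGHT-TRIVIALISED velocity used by
✓`Prop8Criticality.lin_eq_zero_of_isMinOn_of_hasDerivAt`: `t ↦ γ(t)(b)·U₀(b)^*` has derivative `γ′(0)(b)·U₀(b)^*` at `0`. [folklore] -/
theorem hasDerivAt_mul_star_of_differentiableAt (γ : ℝ → GaugeField P j (Matrix.specialUnitaryGroup (Fin 2) ℂ))
    (U₀ : GaugeField P j (Matrix.specialUnitaryGroup (Fin 2) ℂ)) (b : PBond P j)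
    (hd : DifferentiableAt ℝ (fun t : ℝ => (γ t b : Matrix (Fin 2) (Fin 2) ℂ)) 0) :
    HasDerivAt (fun t : ℝ => (γ t b : Matrix (Fin 2) (Fin 2) ℂ) * star (U₀ b : Matrix (Fin 2) (Fin 2) ℂ))
      (deriv (fun t : ℝ => (γ t b : Matrix (Fin 2) (Fin 2) ℂ)) 0 * star (U₀ b : Matrix (Fin 2) (Fin 2) ℂ)) 0 :=
  hd.hasDerivAt.mul_const _

/-- ★★ **THE FIRST VARIATION OF THE WILSON ACTION ALONG A CURVE, AS A DERIVATIVE.**  Let `γ : ℝ → SU(2)^{bonds}` be a curve of configurations on a torus of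
`Setup` with `γ(0) = U₀`, and suppose every right-trivialised bond coordinate `t ↦ γ(t)(b)·U₀(b)^*` has a derivative `ξ(b)` at `t = 0`.  Then
`t ↦ A(γ(t))` is differentiable at `0` with derivative `Lin_{U₀}(ξ) = Σ_p ½Re Tr((U₀(∂p) − 1)^*·L_p(ξ)·U₀(∂p))` — the exact first-order term of
[Balaban1985Variational] (26)–(27) (the tree's `Lin_{U₀}`, verbatim the conclusion of ✓`Prop8Criticality.lin_eq_zero_of_isMinOn_of_hasDerivAt`).  Proof: the
two-sided quadratic expansion ✓`abs_wilsonAction4_sub_sub_lin_le` (`|A(γ t) − A(U₀) − Lin_{U₀}(Y_t)| ≤ 34·4d·Σ_b‖Y_t(b)‖²`, `Y_t(b) = γ(t)(b)U₀(b)^* − 1 = tξ(b) + o(t)`)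
and the `ℝ`-linearity ∕ `ℓ¹`-boundedness of `Lin_{U₀}` (✓`linPlaq_sub_smul`, ✓`abs_linPlaq_le`). [cite: Balaban1985Variational, (26)-(27) p.282] -/
theorem hasDerivAt_wilsonAction4_of_hasDerivAt_bonds {U₀ : GaugeField P j (Matrix.specialUnitaryGroup (Fin 2) ℂ)}
    (γ : ℝ → GaugeField P j (Matrix.specialUnitaryGroup (Fin 2) ℂ)) (hγ0 : γ 0 = U₀) (ξ : PBond P j → Matrix (Fin 2) (Fin 2) ℂ)
    (hγξ : ∀ b : PBond P j,
      HasDerivAt (fun t : ℝ => (γ t b : Matrix (Fin 2) (Fin 2) ℂ) * star (U₀ b : Matrix (Fin 2) (Fin 2) ℂ)) (ξ b) 0) :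
    HasDerivAt (fun t : ℝ => wilsonAction4 (γ t))
      (∑ p : Plaq P j, (1 / 2) * ((((((GaugeField.plaqHol U₀ p : Matrix.specialUnitaryGroup (Fin 2) ℂ) : Matrix (Fin 2) (Fin 2) ℂ)) - 1)ᴴ
          * ((ξ ⟨p.src, p.μ⟩
              + (U₀ ⟨p.src, p.μ⟩ : Matrix (Fin 2) (Fin 2) ℂ) * ξ ⟨p.src.shift p.μ, p.ν⟩ * star (U₀ ⟨p.src, p.μ⟩ : Matrix (Fin 2) (Fin 2) ℂ)
              - ((U₀ ⟨p.src, p.μ⟩ * U₀ ⟨p.src.shift p.μ, p.ν⟩ * (U₀ ⟨p.src.shift p.ν, p.μ⟩)⁻¹ : Matrix.specialUnitaryGroup (Fin 2) ℂ) : Matrix (Fin 2) (Fin 2) ℂ)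
                  * ξ ⟨p.src.shift p.ν, p.μ⟩
                  * star ((U₀ ⟨p.src, p.μ⟩ * U₀ ⟨p.src.shift p.μ, p.ν⟩ * (U₀ ⟨p.src.shift p.ν, p.μ⟩)⁻¹ : Matrix.specialUnitaryGroup (Fin 2) ℂ) : Matrix (Fin 2) (Fin 2) ℂ)
              - ((GaugeField.plaqHol U₀ p : Matrix.specialUnitaryGroup (Fin 2) ℂ) : Matrix (Fin 2) (Fin 2) ℂ) * ξ ⟨p.src, p.ν⟩
                  * star ((GaugeField.plaqHol U₀ p : Matrix.specialUnitaryGroup (Fin 2) ℂ) : Matrix (Fin 2) (Fin 2) ℂ))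
            * ((GaugeField.plaqHol U₀ p : Matrix.specialUnitaryGroup (Fin 2) ℂ) : Matrix (Fin 2) (Fin 2) ℂ))).trace).re) 0 := by
  -- the first variation as a function of the bond field
  set Λ : (PBond P j → Matrix (Fin 2) (Fin 2) ℂ) → ℝ := fun Z =>
    ∑ p : Plaq P j, (1 / 2) * ((((((GaugeField.plaqHol U₀ p : Matrix.specialUnitaryGroup (Fin 2) ℂ) : Matrix (Fin 2) (Fin 2) ℂ)) - 1)ᴴ
          * ((Z ⟨p.src, p.μ⟩
              + (U₀ ⟨p.src, p.μ⟩ : Matrix (Fin 2) (Fin 2) ℂ) * Z ⟨p.src.shift p.μ, p.ν⟩ * star (U₀ ⟨p.src, p.μ⟩ : Matrix (Fin 2) (Fin 2) ℂ)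
              - ((U₀ ⟨p.src, p.μ⟩ * U₀ ⟨p.src.shift p.μ, p.ν⟩ * (U₀ ⟨p.src.shift p.ν, p.μ⟩)⁻¹ : Matrix.specialUnitaryGroup (Fin 2) ℂ) : Matrix (Fin 2) (Fin 2) ℂ)
                  * Z ⟨p.src.shift p.ν, p.μ⟩
                  * star ((U₀ ⟨p.src, p.μ⟩ * U₀ ⟨p.src.shift p.μ, p.ν⟩ * (U₀ ⟨p.src.shift p.ν, p.μ⟩)⁻¹ : Matrix.specialUnitaryGroup (Fin 2) ℂ) : Matrix (Fin 2) (Fin 2) ℂ)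
              - ((GaugeField.plaqHol U₀ p : Matrix.specialUnitaryGroup (Fin 2) ℂ) : Matrix (Fin 2) (Fin 2) ℂ) * Z ⟨p.src, p.ν⟩
                  * star ((GaugeField.plaqHol U₀ p : Matrix.specialUnitaryGroup (Fin 2) ℂ) : Matrix (Fin 2) (Fin 2) ℂ))
            * ((GaugeField.plaqHol U₀ p : Matrix.specialUnitaryGroup (Fin 2) ℂ) : Matrix (Fin 2) (Fin 2) ℂ))).trace).re with hΛ
  change HasDerivAt (fun t : ℝ => wilsonAction4 (γ t)) (Λ ξ) 0
  set Y : ℝ → PBond P j → Matrix (Fin 2) (Fin 2) ℂ := fun t b =>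
    (γ t b : Matrix (Fin 2) (Fin 2) ℂ) * star (U₀ b : Matrix (Fin 2) (Fin 2) ℂ) - 1 with hY
  set M : ℝ := ∑ b : PBond P j, ‖ξ b‖ with hM
  set B : ℝ := (Fintype.card (PBond P j) : ℝ) with hB
  set D : ℝ := (P.d : ℝ) with hD
  have hM0 : 0 ≤ M := Finset.sum_nonneg fun b _ => norm_nonneg _
  have hB0 : 0 ≤ B := Nat.cast_nonneg _
  have hD0 : 0 ≤ D := Nat.cast_nonneg _
  have hMb : ∀ b : PBond P j, ‖ξ b‖ ≤ M := fun b =>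
    Finset.single_le_sum (f := fun b => ‖ξ b‖) (fun b _ => norm_nonneg _) (Finset.mem_univ b)
  -- (1) linearity and the `ℓ¹` bound of `Λ`
  have hlin : ∀ t : ℝ, Λ (Y t) - t * Λ ξ = Λ (fun b => Y t b - (t : ℂ) • ξ b) := by
    intro t
    simp only [hΛ, Finset.mul_sum, ← Finset.sum_sub_distrib]
    exact Finset.sum_congr rfl fun p _ => linPlaq_sub_smul U₀ (Y t) ξ t p
  have hΛle : ∀ W : PBond P j → Matrix (Fin 2) (Fin 2) ℂ, |Λ W| ≤ 2 * (4 * D) * ∑ b : PBond P j, ‖W b‖ := by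
    intro W
    simp only [hΛ]
    refine (Finset.abs_sum_le_sum_abs _ _).trans ?_
    have hper : ∀ p : Plaq P j, _ ≤ 2 * (‖W ⟨p.src, p.μ⟩‖ + ‖W ⟨p.src.shift p.μ, p.ν⟩‖ + ‖W ⟨p.src.shift p.ν, p.μ⟩‖ + ‖W ⟨p.src, p.ν⟩‖) :=
      fun p => (abs_linPlaq_le U₀ W p).trans (mul_le_mul_of_nonneg_right (norm_coe_sub_one_le_two _) (by positivity))
    refine (Finset.sum_le_sum fun p _ => hper p).trans ?_
    rw [← Finset.mul_sum, mul_assoc]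
    exact mul_le_mul_of_nonneg_left (sum_plaq_bonds_le (fun b => ‖W b‖) fun b => norm_nonneg _) zero_le_two
  -- (2) the bondwise little-o defect, uniformly in the finitely many bonds
  have h0 : ∀ b : PBond P j, (γ 0 b : Matrix (Fin 2) (Fin 2) ℂ) * star (U₀ b : Matrix (Fin 2) (Fin 2) ℂ) = 1 := fun b => by
    rw [hγ0]; exact Matrix.mem_unitaryGroup_iff.mp (U₀ b).2.1
  have hdef : ∀ ε : ℝ, 0 < ε → ∀ᶠ t in 𝓝 (0 : ℝ), ∀ b : PBond P j, ‖Y t b - (t : ℂ) • ξ b‖ ≤ ε * |t| := by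
    intro ε hε
    refine Filter.eventually_all.mpr fun b => ?_
    have h1 := (hasDerivAt_iff_isLittleO_nhds_zero).mp (hγξ b)
    filter_upwards [h1.def hε] with t ht
    rw [zero_add, h0, Real.norm_eq_abs] at ht
    rwa [hY, Complex.coe_smul]
  -- (3) the little-o estimate of the action
  rw [hasDerivAt_iff_isLittleO_nhds_zero]
  refine Asymptotics.isLittleO_iff.mpr fun c hc => ?_
  -- slack for the linear defect and the window for the quadratic remainder
  set ε : ℝ := c / 2 / (2 * (4 * D) * B + 1) with hε
  have hεpos : 0 < ε := by positivity
  have hεslack : 2 * (4 * D) * B * ε ≤ c / 2 := by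
    have h1 : 2 * (4 * D) * B * ε ≤ (2 * (4 * D) * B + 1) * ε := mul_le_mul_of_nonneg_right (le_add_of_nonneg_right zero_le_one) hεpos.le
    rw [hε, mul_div_cancel₀ _ (by positivity : (2 : ℝ) * (4 * D) * B + 1 ≠ 0)] at h1
    exact h1
  set t₁ : ℝ := 1 / (4 * (M + ε) + 1) with ht₁
  have ht₁pos : 0 < t₁ := by positivity
  have hwin : t₁ * (M + ε) ≤ 1 / 4 := by
    have h1 : t₁ * (4 * (M + ε) + 1) = 1 := by rw [ht₁, div_mul_cancel₀ _ (by positivity : (4 : ℝ) * (M + ε) + 1 ≠ 0)]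
    have h2 : t₁ * (M + ε) = (1 - t₁) / 4 := by linear_combination h1 / 4
    rw [h2]
    linarith only [ht₁pos]
  set t₂ : ℝ := c / 2 / ((8 * 2 + 18) * (4 * D) * (B * (M + ε) ^ 2) + 1) with ht₂
  have ht₂pos : 0 < t₂ := by positivity
  have hquad : (8 * 2 + 18) * (4 * D) * (B * (M + ε) ^ 2) * t₂ ≤ c / 2 := by
    have h1 : (8 * 2 + 18) * (4 * D) * (B * (M + ε) ^ 2) * t₂ ≤ ((8 * 2 + 18) * (4 * D) * (B * (M + ε) ^ 2) + 1) * t₂ :=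
      mul_le_mul_of_nonneg_right (le_add_of_nonneg_right zero_le_one) ht₂pos.le
    rw [ht₂, mul_div_cancel₀ _ (by positivity : (8 * 2 + 18 : ℝ) * (4 * D) * (B * (M + ε) ^ 2) + 1 ≠ 0)] at h1
    exact h1
  have hsmall : ∀ᶠ t in 𝓝 (0 : ℝ), |t| < min t₁ t₂ := by
    have := Metric.ball_mem_nhds (0 : ℝ) (lt_min ht₁pos ht₂pos)
    filter_upwards [this] with t ht
    rwa [Metric.mem_ball, Real.dist_eq, sub_zero] at ht
  filter_upwards [hdef ε hεpos, hsmall] with t hZ ht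
  have htt₁ : |t| < t₁ := lt_of_lt_of_le ht (min_le_left _ _)
  have htt₂ : |t| < t₂ := lt_of_lt_of_le ht (min_le_right _ _)
  -- bondwise size of the fluctuation
  have hYb : ∀ b : PBond P j, ‖Y t b‖ ≤ |t| * (M + ε) := by
    intro b
    have h1 := hZ b
    have h2 : ‖(t : ℂ) • ξ b‖ = |t| * ‖ξ b‖ := by rw [norm_smul, Complex.norm_real, Real.norm_eq_abs]
    have h3 : ‖Y t b‖ ≤ ‖(t : ℂ) • ξ b‖ + ‖Y t b - (t : ℂ) • ξ b‖ := by
      have := norm_add_le ((t : ℂ) • ξ b) (Y t b - (t : ℂ) • ξ b); rwa [add_sub_cancel] at this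
    have h6 : |t| * ‖ξ b‖ ≤ |t| * M := mul_le_mul_of_nonneg_left (hMb b) (abs_nonneg t)
    calc ‖Y t b‖ ≤ ‖(t : ℂ) • ξ b‖ + ‖Y t b - (t : ℂ) • ξ b‖ := h3
      _ ≤ |t| * M + ε * |t| := by rw [h2]; exact add_le_add h6 h1
      _ = |t| * (M + ε) := by ring
  have hδ : ∀ b : PBond P j, ‖(γ t b : Matrix (Fin 2) (Fin 2) ℂ) * star (U₀ b : Matrix (Fin 2) (Fin 2) ℂ) - 1‖ ≤ |t| * (M + ε) := hYb
  have hδ4 : |t| * (M + ε) ≤ 1 / 4 := (mul_le_mul_of_nonneg_right htt₁.le (by positivity)).trans hwin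
  -- the quadratic remainder
  have h2 := abs_wilsonAction4_sub_sub_lin_le (γ t) U₀ zero_le_two (fun p => norm_coe_sub_one_le_two _) hδ hδ4
  change |wilsonAction4 (γ t) - wilsonAction4 U₀ - Λ (Y t)| ≤ (8 * 2 + 18) * (4 * P.d) * ∑ b : PBond P j, ‖Y t b‖ ^ 2 at h2
  have hs1 : ∑ b : PBond P j, ‖Y t b‖ ^ 2 ≤ B * (|t| * (M + ε)) ^ 2 := by
    calc ∑ b : PBond P j, ‖Y t b‖ ^ 2 ≤ ∑ _b : PBond P j, (|t| * (M + ε)) ^ 2 :=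
          Finset.sum_le_sum fun b _ => pow_le_pow_left₀ (norm_nonneg _) (hYb b) 2
      _ = B * (|t| * (M + ε)) ^ 2 := by rw [Finset.sum_const, Finset.card_univ, nsmul_eq_mul]
  -- the linear defect
  have hs2 : ∑ b : PBond P j, ‖Y t b - (t : ℂ) • ξ b‖ ≤ B * (ε * |t|) := by
    calc ∑ b : PBond P j, ‖Y t b - (t : ℂ) • ξ b‖ ≤ ∑ _b : PBond P j, ε * |t| := Finset.sum_le_sum fun b _ => hZ b
      _ = B * (ε * |t|) := by rw [Finset.sum_const, Finset.card_univ, nsmul_eq_mul]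
  have h3 := hΛle (fun b => Y t b - (t : ℂ) • ξ b)
  rw [← hlin t] at h3
  -- assemble
  have hA0 : wilsonAction4 (γ (0 + t)) - wilsonAction4 (γ 0) - t • Λ ξ
      = (wilsonAction4 (γ t) - wilsonAction4 U₀ - Λ (Y t)) + (Λ (Y t) - t * Λ ξ) := by
    rw [zero_add, hγ0, smul_eq_mul]; ring
  rw [hA0, Real.norm_eq_abs, Real.norm_eq_abs]
  refine (abs_add_le _ _).trans ?_
  have ht2 : (|t| * (M + ε)) ^ 2 = (M + ε) ^ 2 * (|t| * |t|) := by ring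
  have e1 : |wilsonAction4 (γ t) - wilsonAction4 U₀ - Λ (Y t)| ≤ c / 2 * |t| := by
    refine h2.trans ?_
    have hP : (8 * 2 + 18) * (4 * (P.d : ℝ)) * ∑ b : PBond P j, ‖Y t b‖ ^ 2
        ≤ (8 * 2 + 18) * (4 * D) * (B * (M + ε) ^ 2) * |t| * |t| := by
      have := mul_le_mul_of_nonneg_left hs1 (by positivity : (0 : ℝ) ≤ (8 * 2 + 18) * (4 * D))
      rw [ht2] at this
      calc _ ≤ (8 * 2 + 18) * (4 * D) * (B * ((M + ε) ^ 2 * (|t| * |t|))) := this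
        _ = (8 * 2 + 18) * (4 * D) * (B * (M + ε) ^ 2) * |t| * |t| := by ring
    refine hP.trans ?_
    have hK0 : 0 ≤ (8 * 2 + 18) * (4 * D) * (B * (M + ε) ^ 2) := by positivity
    have h4 : (8 * 2 + 18) * (4 * D) * (B * (M + ε) ^ 2) * |t| ≤ c / 2 :=
      (mul_le_mul_of_nonneg_left htt₂.le hK0).trans hquad
    exact mul_le_mul_of_nonneg_right h4 (abs_nonneg t)
  have e2 : |Λ (Y t) - t * Λ ξ| ≤ c / 2 * |t| := by
    refine h3.trans ?_
    calc 2 * (4 * D) * ∑ b : PBond P j, ‖Y t b - (t : ℂ) • ξ b‖ ≤ 2 * (4 * D) * (B * (ε * |t|)) :=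
          mul_le_mul_of_nonneg_left hs2 (by positivity)
      _ = 2 * (4 * D) * B * ε * |t| := by ring
      _ ≤ c / 2 * |t| := mul_le_mul_of_nonneg_right hεslack (abs_nonneg t)
  calc |wilsonAction4 (γ t) - wilsonAction4 U₀ - Λ (Y t)| + |Λ (Y t) - t * Λ ξ| ≤ c / 2 * |t| + c / 2 * |t| := add_le_add e1 e2
    _ = c * |t| := by ring


/-- `deriv` form of ✓`hasDerivAt_wilsonAction4_of_hasDerivAt_bonds`: `(d/dt) A(γ t)|₀ = Lin_{U₀}(ξ)`. [cite: Balaban1985Variational, (26)-(27) p.282] -/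
theorem deriv_wilsonAction4_eq_lin {U₀ : GaugeField P j (Matrix.specialUnitaryGroup (Fin 2) ℂ)}
    (γ : ℝ → GaugeField P j (Matrix.specialUnitaryGroup (Fin 2) ℂ)) (hγ0 : γ 0 = U₀) (ξ : PBond P j → Matrix (Fin 2) (Fin 2) ℂ)
    (hγξ : ∀ b : PBond P j,
      HasDerivAt (fun t : ℝ => (γ t b : Matrix (Fin 2) (Fin 2) ℂ) * star (U₀ b : Matrix (Fin 2) (Fin 2) ℂ)) (ξ b) 0) :
    deriv (fun t : ℝ => wilsonAction4 (γ t)) 0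
      = ∑ p : Plaq P j, (1 / 2) * ((((((GaugeField.plaqHol U₀ p : Matrix.specialUnitaryGroup (Fin 2) ℂ) : Matrix (Fin 2) (Fin 2) ℂ)) - 1)ᴴ
          * ((ξ ⟨p.src, p.μ⟩
              + (U₀ ⟨p.src, p.μ⟩ : Matrix (Fin 2) (Fin 2) ℂ) * ξ ⟨p.src.shift p.μ, p.ν⟩ * star (U₀ ⟨p.src, p.μ⟩ : Matrix (Fin 2) (Fin 2) ℂ)
              - ((U₀ ⟨p.src, p.μ⟩ * U₀ ⟨p.src.shift p.μ, p.ν⟩ * (U₀ ⟨p.src.shift p.ν, p.μ⟩)⁻¹ : Matrix.specialUnitaryGroup (Fin 2) ℂ) : Matrix (Fin 2) (Fin 2) ℂ)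
                  * ξ ⟨p.src.shift p.ν, p.μ⟩
                  * star ((U₀ ⟨p.src, p.μ⟩ * U₀ ⟨p.src.shift p.μ, p.ν⟩ * (U₀ ⟨p.src.shift p.ν, p.μ⟩)⁻¹ : Matrix.specialUnitaryGroup (Fin 2) ℂ) : Matrix (Fin 2) (Fin 2) ℂ)
              - ((GaugeField.plaqHol U₀ p : Matrix.specialUnitaryGroup (Fin 2) ℂ) : Matrix (Fin 2) (Fin 2) ℂ) * ξ ⟨p.src, p.ν⟩
                  * star ((GaugeField.plaqHol U₀ p : Matrix.specialUnitaryGroup (Fin 2) ℂ) : Matrix (Fin 2) (Fin 2) ℂ))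
            * ((GaugeField.plaqHol U₀ p : Matrix.specialUnitaryGroup (Fin 2) ℂ) : Matrix (Fin 2) (Fin 2) ℂ))).trace).re :=
  (hasDerivAt_wilsonAction4_of_hasDerivAt_bonds γ hγ0 ξ hγξ).deriv

/-- ★ **THE DERIVATIVE IN THE BOND-CURRENT FORM**: under the same hypotheses, `(d/dt) A(γ t)|₀ = −½·Σ_b Re Tr(ξ(b)·(D^{1*}_{U₀}∂U₀)_{b.dir}(b.src))` — the pairing of the
velocity with the covariant divergence of the curvature ([Balaban1985BackgroundPropagators] (3.11) «⟨A, J⟩, J = D^*∂U»; ✓`Prop7FirstVariationCurrent.lin_eq_neg_half_sum_re_trace_mul_covDivT`).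
[cite: Balaban1985BackgroundPropagators, (3.11) p.392] -/
theorem hasDerivAt_wilsonAction4_current {U₀ : GaugeField P j (Matrix.specialUnitaryGroup (Fin 2) ℂ)}
    (γ : ℝ → GaugeField P j (Matrix.specialUnitaryGroup (Fin 2) ℂ)) (hγ0 : γ 0 = U₀) (ξ : PBond P j → Matrix (Fin 2) (Fin 2) ℂ)
    (hγξ : ∀ b : PBond P j,
      HasDerivAt (fun t : ℝ => (γ t b : Matrix (Fin 2) (Fin 2) ℂ) * star (U₀ b : Matrix (Fin 2) (Fin 2) ℂ)) (ξ b) 0) :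
    HasDerivAt (fun t : ℝ => wilsonAction4 (γ t))
      (-(1 / 2) * ∑ b : PBond P j, ((ξ b * covDivT 1 (unitsField (toUField U₀)) b.dir b.src).trace).re) 0 := by
  have h := hasDerivAt_wilsonAction4_of_hasDerivAt_bonds γ hγ0 ξ hγξ
  rwa [lin_eq_neg_half_sum_re_trace_mul_covDivT U₀ ξ] at h

/-- The first variation along a curve given in the `DifferentiableAt` letters of LEAD-H's stationarity clause (`RoomHalvingTextStat`, EX knit ✓`…StubEXOfChartPiecesTwSL` :179–182):
if every bond matrix `t ↦ γ(t)(b)` is differentiable at `0`, then `t ↦ A(γ t)` has derivative `Lin_{γ 0}(ξ)` at `0` with `ξ(b) = γ′(0)(b)·γ(0)(b)^*`. [cite: Balaban1985Variational, (26)-(27) p.282] -/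
theorem hasDerivAt_wilsonAction4_of_differentiableAt_bonds (γ : ℝ → GaugeField P j (Matrix.specialUnitaryGroup (Fin 2) ℂ))
    (hd : ∀ b : PBond P j, DifferentiableAt ℝ (fun t : ℝ => (γ t b : Matrix (Fin 2) (Fin 2) ℂ)) 0) :
    HasDerivAt (fun t : ℝ => wilsonAction4 (γ t))
      (∑ p : Plaq P j, (1 / 2) * ((((((GaugeField.plaqHol (γ 0) p : Matrix.specialUnitaryGroup (Fin 2) ℂ) : Matrix (Fin 2) (Fin 2) ℂ)) - 1)ᴴ
          * (((deriv (fun t : ℝ => (γ t ⟨p.src, p.μ⟩ : Matrix (Fin 2) (Fin 2) ℂ)) 0 * star (γ 0 ⟨p.src, p.μ⟩ : Matrix (Fin 2) (Fin 2) ℂ))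
              + ((γ 0) ⟨p.src, p.μ⟩ : Matrix (Fin 2) (Fin 2) ℂ) * (deriv (fun t : ℝ => (γ t ⟨p.src.shift p.μ, p.ν⟩ : Matrix (Fin 2) (Fin 2) ℂ)) 0 * star (γ 0 ⟨p.src.shift p.μ, p.ν⟩ : Matrix (Fin 2) (Fin 2) ℂ)) * star ((γ 0) ⟨p.src, p.μ⟩ : Matrix (Fin 2) (Fin 2) ℂ)
              - (((γ 0) ⟨p.src, p.μ⟩ * (γ 0) ⟨p.src.shift p.μ, p.ν⟩ * ((γ 0) ⟨p.src.shift p.ν, p.μ⟩)⁻¹ : Matrix.specialUnitaryGroup (Fin 2) ℂ) : Matrix (Fin 2) (Fin 2) ℂ)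
                  * (deriv (fun t : ℝ => (γ t ⟨p.src.shift p.ν, p.μ⟩ : Matrix (Fin 2) (Fin 2) ℂ)) 0 * star (γ 0 ⟨p.src.shift p.ν, p.μ⟩ : Matrix (Fin 2) (Fin 2) ℂ))
                  * star (((γ 0) ⟨p.src, p.μ⟩ * (γ 0) ⟨p.src.shift p.μ, p.ν⟩ * ((γ 0) ⟨p.src.shift p.ν, p.μ⟩)⁻¹ : Matrix.specialUnitaryGroup (Fin 2) ℂ) : Matrix (Fin 2) (Fin 2) ℂ)
              - ((GaugeField.plaqHol (γ 0) p : Matrix.specialUnitaryGroup (Fin 2) ℂ) : Matrix (Fin 2) (Fin 2) ℂ) * (deriv (fun t : ℝ => (γ t ⟨p.src, p.ν⟩ : Matrix (Fin 2) (Fin 2) ℂ)) 0 * star (γ 0 ⟨p.src, p.ν⟩ : Matrix (Fin 2) (Fin 2) ℂ))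
                  * star ((GaugeField.plaqHol (γ 0) p : Matrix.specialUnitaryGroup (Fin 2) ℂ) : Matrix (Fin 2) (Fin 2) ℂ))
            * ((GaugeField.plaqHol (γ 0) p : Matrix.specialUnitaryGroup (Fin 2) ℂ) : Matrix (Fin 2) (Fin 2) ℂ))).trace).re) 0 :=
  hasDerivAt_wilsonAction4_of_hasDerivAt_bonds γ rfl (fun b => deriv (fun t : ℝ => (γ t b : Matrix (Fin 2) (Fin 2) ℂ)) 0 * star (γ 0 b : Matrix (Fin 2) (Fin 2) ℂ))
    fun b => hasDerivAt_mul_star_of_differentiableAt γ (γ 0) b (hd b)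

end Member

/-! ## §2 The push-forward of the first variation along the `L^{jc}`-fold cover -/

section Cover

variable (P : Params) (jc : ℕ) {j : ℕ}

/-- **THE CURRENT PAIRING OF THE LIFT IS THE MEMBER'S PAIRING WITH THE PUSH-FORWARD** (`SU(N)`, any level `j` of `Setup`): for a member background `U₀` lifted to
the cover as `U₀ ∘ π` and any cover bond field `ξ̃`, `Σ_{b̃} Re Tr(ξ̃(b̃)·(D^{1*}_{U₀∘π}∂(U₀∘π))(b̃)) = Σ_b Re Tr((π_* ξ̃)(b)·(D^{1*}_{U₀}∂U₀)(b))` — the covariant divergence of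
the lift is the lift of the covariant divergence (★w3-20520 g5's FILE 1 ✓`SmallMembersCoverLift.covDivT_comp_proj`) and `Σ_{b̃} f(π b̃)·g(b̃) = Σ_b f(b)·(π_* g)(b)`
(✓`CoverSites.sum_pullback_mul_eq_sum_mul_pushBond`). [cite: Balaban1985BackgroundPropagators, (3.11) p.392] -/
theorem sum_re_trace_mul_covDivT_cover_eq_pushBond {N : ℕ} [DecidableEq (PBond P j)]
    (U₀ : GaugeField P j (Matrix.specialUnitaryGroup (Fin N) ℂ)) (ξt : PBond (cover P jc) j → Matrix (Fin N) (Fin N) ℂ) :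
    ∑ bt : PBond (cover P jc) j, ((ξt bt * covDivT 1 (unitsField (toUField (U₀ ∘ projBond P jc j))) bt.dir bt.src).trace).re
      = ∑ b : PBond P j, ((pushBond P jc j ξt b * covDivT 1 (unitsField (toUField U₀)) b.dir b.src).trace).re := by
  have hlift : unitsField (toUField (U₀ ∘ projBond P jc j)) = unitsField (toUField U₀) ∘ projBond P jc j := rfl
  -- the current of the lift is the lift of the current
  have hJ : ∀ bt : PBond (cover P jc) j,
      covDivT 1 (unitsField (toUField (U₀ ∘ projBond P jc j))) bt.dir bt.src
        = (fun b : PBond P j => covDivT 1 (unitsField (toUField U₀)) b.dir b.src) (projBond P jc j bt) := fun bt => by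
    rw [hlift, SmallMembersCoverLift.covDivT_comp_proj]; rfl
  -- the real trace as an additive map
  set τ : Matrix (Fin N) (Fin N) ℂ →+ ℝ := Complex.reAddGroupHom.comp (Matrix.traceAddMonoidHom (Fin N) ℂ) with hτ
  have hτapp : ∀ X : Matrix (Fin N) (Fin N) ℂ, τ X = (X.trace).re := fun X => rfl
  calc ∑ bt : PBond (cover P jc) j, ((ξt bt * covDivT 1 (unitsField (toUField (U₀ ∘ projBond P jc j))) bt.dir bt.src).trace).re
      = ∑ bt : PBond (cover P jc) j,
          τ ((fun b : PBond P j => covDivT 1 (unitsField (toUField U₀)) b.dir b.src) (projBond P jc j bt) * ξt bt) := by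
        refine Finset.sum_congr rfl fun bt _ => ?_
        rw [hJ bt, ← hτapp]
        exact re_trace_mul_comm _ _
    _ = τ (∑ bt : PBond (cover P jc) j, (fun b : PBond P j => covDivT 1 (unitsField (toUField U₀)) b.dir b.src) (projBond P jc j bt) * ξt bt) :=
        (map_sum τ _ _).symm
    _ = τ (∑ b : PBond P j, (fun b : PBond P j => covDivT 1 (unitsField (toUField U₀)) b.dir b.src) b * pushBond P jc j ξt b) := by
        rw [sum_pullback_mul_eq_sum_mul_pushBond P jc j (fun b : PBond P j => covDivT 1 (unitsField (toUField U₀)) b.dir b.src) ξt]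
    _ = ∑ b : PBond P j, τ ((fun b : PBond P j => covDivT 1 (unitsField (toUField U₀)) b.dir b.src) b * pushBond P jc j ξt b) :=
        map_sum τ _ _
    _ = ∑ b : PBond P j, ((pushBond P jc j ξt b * covDivT 1 (unitsField (toUField U₀)) b.dir b.src).trace).re := by
        refine Finset.sum_congr rfl fun b _ => ?_
        rw [← hτapp]
        exact re_trace_mul_comm _ _

/-- ★★ **THE FIRST VARIATION AT A LIFTED BACKGROUND PUSHES FORWARD**: `Lin_{U₀ ∘ π}(ξ̃) = Lin_{U₀}(π_* ξ̃)` for every `SU(N)` member background `U₀` and every cover bond field `ξ̃`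
(`π_* = CoverSites.pushBond`, the sum over the deck orbit of a bond).  Both sides are the tree's inline first-variation functional ([Balaban1985Variational] (26)–(27)); the proof
reads them as current pairings ((3.11)) and applies `sum_re_trace_mul_covDivT_cover_eq_pushBond`. [cite: Balaban1985Variational, (26)-(27) p.282, (144) p.300] -/
theorem lin_cover_eq_lin_pushBond {N : ℕ} [NeZero N] [DecidableEq (PBond P j)]
    (U₀ : GaugeField P j (Matrix.specialUnitaryGroup (Fin N) ℂ)) (ξt : PBond (cover P jc) j → Matrix (Fin N) (Fin N) ℂ) :
    ∑ p : Plaq (cover P jc) j, (1 / 2) * ((((((GaugeField.plaqHol (U₀ ∘ projBond P jc j) p : Matrix.specialUnitaryGroup (Fin N) ℂ) : Matrix (Fin N) (Fin N) ℂ)) - 1)ᴴ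
          * ((ξt ⟨p.src, p.μ⟩
              + ((U₀ ∘ projBond P jc j) ⟨p.src, p.μ⟩ : Matrix (Fin N) (Fin N) ℂ) * ξt ⟨p.src.shift p.μ, p.ν⟩ * star ((U₀ ∘ projBond P jc j) ⟨p.src, p.μ⟩ : Matrix (Fin N) (Fin N) ℂ)
              - (((U₀ ∘ projBond P jc j) ⟨p.src, p.μ⟩ * (U₀ ∘ projBond P jc j) ⟨p.src.shift p.μ, p.ν⟩ * ((U₀ ∘ projBond P jc j) ⟨p.src.shift p.ν, p.μ⟩)⁻¹ : Matrix.specialUnitaryGroup (Fin N) ℂ) : Matrix (Fin N) (Fin N) ℂ)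
                  * ξt ⟨p.src.shift p.ν, p.μ⟩
                  * star (((U₀ ∘ projBond P jc j) ⟨p.src, p.μ⟩ * (U₀ ∘ projBond P jc j) ⟨p.src.shift p.μ, p.ν⟩ * ((U₀ ∘ projBond P jc j) ⟨p.src.shift p.ν, p.μ⟩)⁻¹ : Matrix.specialUnitaryGroup (Fin N) ℂ) : Matrix (Fin N) (Fin N) ℂ)
              - ((GaugeField.plaqHol (U₀ ∘ projBond P jc j) p : Matrix.specialUnitaryGroup (Fin N) ℂ) : Matrix (Fin N) (Fin N) ℂ) * ξt ⟨p.src, p.ν⟩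
                  * star ((GaugeField.plaqHol (U₀ ∘ projBond P jc j) p : Matrix.specialUnitaryGroup (Fin N) ℂ) : Matrix (Fin N) (Fin N) ℂ))
            * ((GaugeField.plaqHol (U₀ ∘ projBond P jc j) p : Matrix.specialUnitaryGroup (Fin N) ℂ) : Matrix (Fin N) (Fin N) ℂ))).trace).re
      = ∑ p : Plaq P j, (1 / 2) * ((((((GaugeField.plaqHol U₀ p : Matrix.specialUnitaryGroup (Fin N) ℂ) : Matrix (Fin N) (Fin N) ℂ)) - 1)ᴴ
          * ((pushBond P jc j ξt ⟨p.src, p.μ⟩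
              + (U₀ ⟨p.src, p.μ⟩ : Matrix (Fin N) (Fin N) ℂ) * pushBond P jc j ξt ⟨p.src.shift p.μ, p.ν⟩ * star (U₀ ⟨p.src, p.μ⟩ : Matrix (Fin N) (Fin N) ℂ)
              - ((U₀ ⟨p.src, p.μ⟩ * U₀ ⟨p.src.shift p.μ, p.ν⟩ * (U₀ ⟨p.src.shift p.ν, p.μ⟩)⁻¹ : Matrix.specialUnitaryGroup (Fin N) ℂ) : Matrix (Fin N) (Fin N) ℂ)
                  * pushBond P jc j ξt ⟨p.src.shift p.ν, p.μ⟩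
                  * star ((U₀ ⟨p.src, p.μ⟩ * U₀ ⟨p.src.shift p.μ, p.ν⟩ * (U₀ ⟨p.src.shift p.ν, p.μ⟩)⁻¹ : Matrix.specialUnitaryGroup (Fin N) ℂ) : Matrix (Fin N) (Fin N) ℂ)
              - ((GaugeField.plaqHol U₀ p : Matrix.specialUnitaryGroup (Fin N) ℂ) : Matrix (Fin N) (Fin N) ℂ) * pushBond P jc j ξt ⟨p.src, p.ν⟩
                  * star ((GaugeField.plaqHol U₀ p : Matrix.specialUnitaryGroup (Fin N) ℂ) : Matrix (Fin N) (Fin N) ℂ))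
            * ((GaugeField.plaqHol U₀ p : Matrix.specialUnitaryGroup (Fin N) ℂ) : Matrix (Fin N) (Fin N) ℂ))).trace).re := by
  rw [lin_eq_neg_half_sum_re_trace_mul_covDivT (U₀ ∘ projBond P jc j) ξt, lin_eq_neg_half_sum_re_trace_mul_covDivT U₀ (pushBond P jc j ξt),
    sum_re_trace_mul_covDivT_cover_eq_pushBond]

/-- ★★ **THE DERIVATIVE OF THE WILSON ACTION ALONG A COVER CURVE THROUGH A LIFT** (`SU(2)`): if `γ̃(0) = U₀ ∘ π` and every right-trivialised cover bond coordinate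
`t ↦ γ̃(t)(b̃)·U₀(π b̃)^*` has derivative `ξ̃(b̃)` at `0`, then `t ↦ A(γ̃ t)` has derivative `Lin_{U₀}(π_* ξ̃)` at `0` — the MEMBER's first variation applied to the push-forward of
the velocity.  (`dÃ(Ũ)[Ẏ] = dA(U)[π_*Ẏ]`, ★w3-20520 g5's COVERLIFT-LOCATE (i)(b).) [cite: Balaban1985Variational, (26)-(27) p.282, (144) p.300] -/
theorem hasDerivAt_wilsonAction4_cover [DecidableEq (PBond P j)] {U₀ : GaugeField P j (Matrix.specialUnitaryGroup (Fin 2) ℂ)}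
    (γt : ℝ → GaugeField (cover P jc) j (Matrix.specialUnitaryGroup (Fin 2) ℂ)) (hγt0 : γt 0 = U₀ ∘ projBond P jc j)
    (ξt : PBond (cover P jc) j → Matrix (Fin 2) (Fin 2) ℂ)
    (hγtξt : ∀ bt : PBond (cover P jc) j,
      HasDerivAt (fun t : ℝ => (γt t bt : Matrix (Fin 2) (Fin 2) ℂ) * star (U₀ (projBond P jc j bt) : Matrix (Fin 2) (Fin 2) ℂ)) (ξt bt) 0) :
    HasDerivAt (fun t : ℝ => wilsonAction4 (γt t))
      (∑ p : Plaq P j, (1 / 2) * ((((((GaugeField.plaqHol U₀ p : Matrix.specialUnitaryGroup (Fin 2) ℂ) : Matrix (Fin 2) (Fin 2) ℂ)) - 1)ᴴ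
          * ((pushBond P jc j ξt ⟨p.src, p.μ⟩
              + (U₀ ⟨p.src, p.μ⟩ : Matrix (Fin 2) (Fin 2) ℂ) * pushBond P jc j ξt ⟨p.src.shift p.μ, p.ν⟩ * star (U₀ ⟨p.src, p.μ⟩ : Matrix (Fin 2) (Fin 2) ℂ)
              - ((U₀ ⟨p.src, p.μ⟩ * U₀ ⟨p.src.shift p.μ, p.ν⟩ * (U₀ ⟨p.src.shift p.ν, p.μ⟩)⁻¹ : Matrix.specialUnitaryGroup (Fin 2) ℂ) : Matrix (Fin 2) (Fin 2) ℂ)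
                  * pushBond P jc j ξt ⟨p.src.shift p.ν, p.μ⟩
                  * star ((U₀ ⟨p.src, p.μ⟩ * U₀ ⟨p.src.shift p.μ, p.ν⟩ * (U₀ ⟨p.src.shift p.ν, p.μ⟩)⁻¹ : Matrix.specialUnitaryGroup (Fin 2) ℂ) : Matrix (Fin 2) (Fin 2) ℂ)
              - ((GaugeField.plaqHol U₀ p : Matrix.specialUnitaryGroup (Fin 2) ℂ) : Matrix (Fin 2) (Fin 2) ℂ) * pushBond P jc j ξt ⟨p.src, p.ν⟩
                  * star ((GaugeField.plaqHol U₀ p : Matrix.specialUnitaryGroup (Fin 2) ℂ) : Matrix (Fin 2) (Fin 2) ℂ))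
            * ((GaugeField.plaqHol U₀ p : Matrix.specialUnitaryGroup (Fin 2) ℂ) : Matrix (Fin 2) (Fin 2) ℂ))).trace).re) 0 := by
  have h := hasDerivAt_wilsonAction4_of_hasDerivAt_bonds (U₀ := U₀ ∘ projBond P jc j) γt hγt0 ξt hγtξt
  rwa [lin_cover_eq_lin_pushBond] at h

/-- ★ **COVER CURVE VERSUS MEMBER CURVE**: if in addition `γ` is a member curve through `U₀` whose right-trivialised velocity is the push-forward `π_* ξ̃`, then
`(d/dt) A(γ̃ t)|₀ = (d/dt) A(γ t)|₀`. [cite: Balaban1985Variational, (26)-(27) p.282, (144) p.300] -/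
theorem deriv_wilsonAction4_cover_eq [DecidableEq (PBond P j)] {U₀ : GaugeField P j (Matrix.specialUnitaryGroup (Fin 2) ℂ)}
    (γt : ℝ → GaugeField (cover P jc) j (Matrix.specialUnitaryGroup (Fin 2) ℂ)) (hγt0 : γt 0 = U₀ ∘ projBond P jc j)
    (ξt : PBond (cover P jc) j → Matrix (Fin 2) (Fin 2) ℂ)
    (hγtξt : ∀ bt : PBond (cover P jc) j,
      HasDerivAt (fun t : ℝ => (γt t bt : Matrix (Fin 2) (Fin 2) ℂ) * star (U₀ (projBond P jc j bt) : Matrix (Fin 2) (Fin 2) ℂ)) (ξt bt) 0)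
    (γ : ℝ → GaugeField P j (Matrix.specialUnitaryGroup (Fin 2) ℂ)) (hγ0 : γ 0 = U₀)
    (hγξ : ∀ b : PBond P j,
      HasDerivAt (fun t : ℝ => (γ t b : Matrix (Fin 2) (Fin 2) ℂ) * star (U₀ b : Matrix (Fin 2) (Fin 2) ℂ)) (pushBond P jc j ξt b) 0) :
    deriv (fun t : ℝ => wilsonAction4 (γt t)) 0 = deriv (fun t : ℝ => wilsonAction4 (γ t)) 0 := by
  rw [(hasDerivAt_wilsonAction4_cover P jc γt hγt0 ξt hγtξt).deriv, deriv_wilsonAction4_eq_lin γ hγ0 (pushBond P jc j ξt) hγξ]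


/-- T³ reading of ✓`hasDerivAt_wilsonAction4_cover`: the derivative of the Wilson action of the COVER MEMBER `F.cover jc` along a curve through the lift of a run-`K`
configuration `U₀` of `F` is `Lin_{U₀}(π_* ξ̃)`. [cite: Balaban1985Variational, (26)-(27) p.282, (144) p.300] -/
theorem hasDerivAt_wilsonAction4_cover_T3 (F : T3Family) (jc K : ℕ) [DecidableEq (PBond (F.P K) 0)]
    {U₀ : GaugeField (F.P K) 0 (Matrix.specialUnitaryGroup (Fin 2) ℂ)}
    (γt : ℝ → GaugeField ((F.cover jc).P K) 0 (Matrix.specialUnitaryGroup (Fin 2) ℂ)) (hγt0 : γt 0 = U₀ ∘ projBond (F.P K) jc 0)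
    (ξt : PBond ((F.cover jc).P K) 0 → Matrix (Fin 2) (Fin 2) ℂ)
    (hγtξt : ∀ bt : PBond ((F.cover jc).P K) 0,
      HasDerivAt (fun t : ℝ => (γt t bt : Matrix (Fin 2) (Fin 2) ℂ) * star (U₀ (projBond (F.P K) jc 0 bt) : Matrix (Fin 2) (Fin 2) ℂ)) (ξt bt) 0) :
    HasDerivAt (fun t : ℝ => wilsonAction4 (γt t))
      (∑ p : Plaq (F.P K) 0, (1 / 2) * ((((((GaugeField.plaqHol U₀ p : Matrix.specialUnitaryGroup (Fin 2) ℂ) : Matrix (Fin 2) (Fin 2) ℂ)) - 1)ᴴ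
          * ((pushBond (F.P K) jc 0 ξt ⟨p.src, p.μ⟩
              + (U₀ ⟨p.src, p.μ⟩ : Matrix (Fin 2) (Fin 2) ℂ) * pushBond (F.P K) jc 0 ξt ⟨p.src.shift p.μ, p.ν⟩ * star (U₀ ⟨p.src, p.μ⟩ : Matrix (Fin 2) (Fin 2) ℂ)
              - ((U₀ ⟨p.src, p.μ⟩ * U₀ ⟨p.src.shift p.μ, p.ν⟩ * (U₀ ⟨p.src.shift p.ν, p.μ⟩)⁻¹ : Matrix.specialUnitaryGroup (Fin 2) ℂ) : Matrix (Fin 2) (Fin 2) ℂ)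
                  * pushBond (F.P K) jc 0 ξt ⟨p.src.shift p.ν, p.μ⟩
                  * star ((U₀ ⟨p.src, p.μ⟩ * U₀ ⟨p.src.shift p.μ, p.ν⟩ * (U₀ ⟨p.src.shift p.ν, p.μ⟩)⁻¹ : Matrix.specialUnitaryGroup (Fin 2) ℂ) : Matrix (Fin 2) (Fin 2) ℂ)
              - ((GaugeField.plaqHol U₀ p : Matrix.specialUnitaryGroup (Fin 2) ℂ) : Matrix (Fin 2) (Fin 2) ℂ) * pushBond (F.P K) jc 0 ξt ⟨p.src, p.ν⟩
                  * star ((GaugeField.plaqHol U₀ p : Matrix.specialUnitaryGroup (Fin 2) ℂ) : Matrix (Fin 2) (Fin 2) ℂ))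
            * ((GaugeField.plaqHol U₀ p : Matrix.specialUnitaryGroup (Fin 2) ℂ) : Matrix (Fin 2) (Fin 2) ℂ))).trace).re) 0 :=
  hasDerivAt_wilsonAction4_cover (F.P K) jc γt hγt0 ξt hγtξt

end Cover


end Summit.QuantumFields.YangMills.Theorems.WilsonActionFirstVariation

end
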